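import Literature.Probability.RandomPlanarGeometry.HexSAWRotStripIdentityY
import Literature.Probability.RandomPlanarGeometry.HexSAWRotTourFrame
import Literature.Probability.RandomPlanarGeometry.HexSAWRotStripLimit
import Mathlib.Data.List.DropRight
import HarnessLib

/-!
# The last-contact cut in Beaton's rotated strip (face Y2 of the lane's door R96 «BEATON-YC»)

Topic `Literature/Probability/RandomPlanarGeometry`; lane «pcv-sawmu», door R96 (planner a-idea-1 g17 `Sketch_G17.lean`, face
**Y2 `RotArchCutLim`**), prover a-p6 g7.  Source: N. R. Beaton, *The critical surface fugacity of self-avoiding walks on a rotated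
honeycomb lattice*, J. Phys. A 47 (2014) 075003 (arXiv:1210.0274v3), §4, «Proof of Proposition 11» (arXiv v3 p. 18, Figure 7: a walk of
the taller strip with a surface contact is cut at its LAST contact; the first piece is a `B`-walk of the same strip carrying all the `y`-weights, the
second piece, reversed, is a walk of the strip of height one less), with the `y`-weighted classes of Beaton §2.4 (`HV.rotGFy`,
`HV.topContacts` of `HexSAWRotStripIdentityY`).  CONSTANTS: the PRINTED inequality is
`A^O_{T+1}(x_c,y) − A^O_T(x_c,1) ≤ ((1+x_c)/2) · B_{T+1}(x_c,y) · B_T(x_c,1)` with `(1+x_c)/2 ≤ 1` in Beaton's two-sided normalisation; the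
constant `x_c⁻¹` below is the lane's, for the right-started classes `HV.rotGF` / `HV.rotGFy` of the tree (one half of Beaton's walks,
one fugacity factor per visited vertex) — not a discrepancy with the print.

For `H ≥ 1`, `W`, `y ≥ 0`, `V₁ = D(H+1, W) ∖ {a⁻}`, `V₀ = D(H, W) ∖ {a⁻}` and a dart class `cls` whose exit vertex lies on the
bottom line `ξ = 0` (the classes `A^O`, `A^I`, `P`):

* `rotGFy_eq_rotGF_add` — the class-`cls` walks of `V₁` with NO contact with the top row `ξ = −(H+1)` are exactly the class-`cls`
  walks of `V₀`, so `X_{H+1,W}(y) = X_{H,W}(1) + Σ_{≥ 1 contact}`;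
* the CUT at the last top contact `v`: `piece₁ = (a → … → v → up)` is a top-class walk of `V₁` carrying ALL the contacts; the tail
  after `v`, read backwards from its bottom exit vertex `w` and re-based by the lattice automorphism `rebase w` (a translation when
  `w` has the type of `a⁺`, the glide `reflX ∘ shift` when it has the type of `a⁻`; `rebase w w = a⁺`, heights preserved), is a
  top-class walk of `D(H, 2W+1) ∖ {a⁻}` at `y = 1` (`piece₂`); `(piece₁, piece₂)` determines the walk (`cut_injOn`), and
  `x_c^{ℓ(γ)} y^{c(γ)} = x_c⁻¹ · (x_c^{ℓ(piece₁)} y^{c(piece₁)}) · x_c^{ℓ(piece₂)}` (the re-based exit vertex becomes the extra inner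
  vertex `a⁺` of `piece₂`);
* **`rot_arch_cut`** — `X_{H+1,W}(y) − X_{H,W}(1) ≤ x_c⁻¹ · B^{⊥,→}_{H+1,W}(y) · B^{⊥,→}_{H,2W+1}(1)`, and **`rot_arch_cut_iSup`** with
  `⨆_{W'} B^{⊥,→}_{H,W'}(1)` — the lane's face `RotArchCutLim` for the three classes `A^O, A^I, P` with the constant `x_c⁻¹` (the typed
  face carries `2 x_c`; the glue of the sketch takes any constant, cf. `stripByUnbounded_of_faces_c`).
-/

noncomputable section

open Finset Filter Topology

namespace Literature.Probability.RandomPlanarGeometry.SAW.HV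

/-! ### The re-basing automorphism -/

/-- The lattice automorphism re-basing a bottom-line vertex `w` at `a⁺`: the translation `v ↦ v − w` when `w` has the type of
`a⁺ = (0,0,false)`, the glide `reflX ∘ (v ↦ v − w + a⁻)` when `w` has the type of `a⁻ = (0,−1,true)`. [folklore] -/
def rebase (w : HV) : hvGraph ≃g hvGraph :=
  if w.2.2 then (shift (-w.1) (-1 - w.2.1)).trans reflX else shift (-w.1) (-w.2.1)

/-- `rebase w` in coordinates. [cite: Beaton2014RotatedHoneycomb, §2.2 (the rotated frame)] -/
theorem rebase_apply (w v : HV) : rebase w v =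
    if w.2.2 then reflX (v.1 + -w.1, v.2.1 + (-1 - w.2.1), v.2.2) else (v.1 + -w.1, v.2.1 + -w.2.1, v.2.2) := by
  unfold rebase
  split_ifs with h <;> rfl

/-- `rebase w w = a⁺`. [cite: Beaton2014RotatedHoneycomb, §2.2 (the rotated frame)] -/
theorem rebase_self (w : HV) : rebase w w = hvOrigin := by
  obtain ⟨a, b, c⟩ := w
  cases c
  · simp [rebase_apply, hvOrigin]
  · simp only [rebase_apply, if_true]
    have : ((a + -a : ℤ), b + (-1 - b), true) = wOut := by simp [wOut]
    rw [this, reflX_wOut]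

/-- `rebase w` preserves Beaton's height when `w` lies on the bottom line `ξ = 0`. [cite: Beaton2014RotatedHoneycomb, §2.2 (the rotated frame)] -/
theorem xi_rebase {w : HV} (hw : xi w = 0) (v : HV) : xi (rebase w v) = xi v := by
  obtain ⟨a, b, c⟩ := w
  obtain ⟨p, q, r⟩ := v
  cases c
  · simp [rebase_apply, xi, bit] at hw ⊢; omega
  · simp only [rebase_apply, if_true, xi_reflX]
    cases r <;> simp [xi, bit] at hw ⊢ <;> omega

/-- The abscissa of `rebase w v`: `X v − X w + 4` (translation) resp. `X w − X v + 4` (glide). [cite: Beaton2014RotatedHoneycomb, §2.2 (the rotated frame)] -/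
theorem xX_rebase (w v : HV) : xX (rebase w v) = if w.2.2 then xX w - xX v + 4 else xX v - xX w + 4 := by
  obtain ⟨a, b, c⟩ := w
  obtain ⟨p, q, r⟩ := v
  cases c
  · cases r <;> simp [rebase_apply, xX, bit] <;> ring
  · simp only [rebase_apply, if_true, xX_reflX]
    cases r <;> simp [xX, bit] <;> ring

/-- `|X(rebase w v) − 3| ≤ |X v − X w| + 1`. [cite: Beaton2014RotatedHoneycomb, §2.2 (the rotated frame)] -/
theorem abs_xX_rebase (w v : HV) : |xX (rebase w v) - 3| ≤ |xX v - xX w| + 1 := by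
  rw [xX_rebase]
  split_ifs
  · calc |xX w - xX v + 4 - 3| = |-(xX v - xX w) + 1| := by ring_nf
      _ ≤ |-(xX v - xX w)| + |(1:ℤ)| := abs_add_le _ _
      _ = |xX v - xX w| + 1 := by rw [abs_neg, abs_one]
  · calc |xX v - xX w + 4 - 3| = |(xX v - xX w) + 1| := by ring_nf
      _ ≤ |xX v - xX w| + |(1:ℤ)| := abs_add_le _ _
      _ = |xX v - xX w| + 1 := by rw [abs_one]

/-- The type of `rebase w v` is `type v XOR type w` (translations preserve the type, the glide flips it).
[cite: Beaton2014RotatedHoneycomb, §2.2 (the rotated frame)] -/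
theorem rebase_type (w v : HV) : (rebase w v).2.2 = xor v.2.2 w.2.2 := by
  obtain ⟨a, b, c⟩ := w
  obtain ⟨p, q, r⟩ := v
  cases c <;> cases r <;> simp [rebase_apply, reflX_apply]

/-- `rebase` is determined by one value: `rebase w v = rebase w' v → w = w'`. [folklore] -/
private theorem rebase_inj_param {w w' v : HV} (h : rebase w v = rebase w' v) : w = w' := by
  have ht := congrArg (fun u : HV => u.2.2) h
  simp only [rebase_type] at ht
  obtain ⟨a, b, c⟩ := w
  obtain ⟨a', b', c'⟩ := w'
  obtain ⟨p, q, r⟩ := v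
  have hcc : c = c' := by cases c <;> cases c' <;> cases r <;> simp at ht <;> rfl
  subst hcc
  cases c
  · simp [rebase_apply, Prod.ext_iff] at h
    refine Prod.ext ?_ (Prod.ext ?_ rfl) <;> simp <;> omega
  · simp only [rebase_apply, if_true] at h
    have h2 := congrArg reflX h
    rw [reflX_reflX, reflX_reflX] at h2
    simp [Prod.ext_iff] at h2
    refine Prod.ext ?_ (Prod.ext ?_ rfl) <;> simp <;> omega

/-- `D(H, W) ⊆ D(H', W)` for `H ≤ H'`. [cite: Beaton2014RotatedHoneycomb, §2.2 (the domain D_{T,L})] -/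
private theorem rotStripV_mono_height' {H H' Wd : ℕ} (h : H ≤ H') : rotStripV H Wd ⊆ rotStripV H' Wd := by
  intro v hv
  have hH : (H : ℤ) ≤ H' := by exact_mod_cast h
  rw [mem_rotStripV_iff] at hv ⊢
  rcases hv with h1 | h1 | ⟨h1, h2, h3⟩
  · exact Or.inl h1
  · exact Or.inr (Or.inl h1)
  · exact Or.inr (Or.inr ⟨h1, h2.trans hH, h3⟩)

/-! ### Splitting the inner list at the last top contact -/

variable {H Wd : ℕ}

/-- the Boolean «not a top-row vertex of `D(H+1, ·)`». [folklore] -/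
private def notTop (H : ℕ) (t : HV) : Bool := decide (xi t ≠ -((H : ℤ) + 1))
/-- the part of the inner list up to and including the LAST top contact. [folklore] -/
private def core (H : ℕ) (P : List HV) : List HV := (inner P).rdropWhile (notTop H)
/-- the part of the inner list after the last top contact. [folklore] -/
private def tl (H : ℕ) (P : List HV) : List HV := (inner P).rtakeWhile (notTop H)
/-- the last top contact (junk value when there is none). [folklore] -/
private def topV (H : ℕ) (P : List HV) : HV := (core H P).getLast?.getD hvOrigin
/-- the exit vertex. [folklore] -/
private def exV (P : List HV) : HV := (finalDart P).2
/-- piece 1: the walk up to its last top contact, closed by the upward half-edge. [folklore] -/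
private def piece₁ (H : ℕ) (P : List HV) : List HV := wOut :: (core H P ++ [xiDown (topV H P)])
/-- piece 2: the tail after the last top contact, reversed from the exit vertex and re-based at `a`. [folklore] -/
private def piece₂ (H : ℕ) (P : List HV) : List HV :=
  wOut :: (((exV P :: (tl H P).reverse).map (rebase (exV P))) ++ [rebase (exV P) (topV H P)])
/-- the cut, as a pair. [folklore] -/
private def cut (H : ℕ) (P : List HV) : List HV × List HV := (piece₁ H P, piece₂ H P)

/-- `topContacts` is a `countP` over the inner list (a-p2's definition). [cite: Beaton2014RotatedHoneycomb, §2.4] -/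
private theorem topContacts_eq (H : ℕ) (P : List HV) :
    topContacts H P = (inner P).countP (fun v => xi v = -(H : ℤ)) := rfl

section Cut

variable {cls : HV × HV → Prop}

/-- Anatomy of a class walk of `V₁ = D(H+1,W) ∖ {a⁻}` with at least one top contact: `P = a⁻ :: (l ++ [w])`, `l = core ++ tl`,
`core` ends at the last top contact `v`, no vertex of `tl` is on the top row, `tl ≠ []`, the exit vertex `w` is on the bottom line.
[cite: Beaton2014RotatedHoneycomb, §4, proof of Proposition 11 (the last surface contact)] -/
private theorem anatomy (hH : 1 ≤ H) (hcls : ∀ d, cls d → xi d.2 = 0) {P : List HV}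
    (hP : IsMidWalk ((rotStripV (H + 1) Wd).erase wOut) P) (hc : cls (finalDart P)) (ht : topContacts (H + 1) P ≠ 0) :
    ∃ (l : List HV) (hl : l ≠ []), P = wOut :: (l ++ [exV P]) ∧ inner P = l ∧ core H P ++ tl H P = l ∧ core H P ≠ [] ∧
      (core H P).getLast? = some (topV H P) ∧ xi (topV H P) = -((H : ℤ) + 1) ∧
      (∀ t ∈ tl H P, xi t ≠ -((H : ℤ) + 1)) ∧ tl H P ≠ [] ∧ xi (exV P) = 0 ∧
      l.IsChain hvGraph.Adj ∧ l.head? = some hvOrigin ∧ hvGraph.Adj (l.getLast hl) (exV P) ∧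
      (∀ x ∈ l, x ∈ (rotStripV (H + 1) Wd).erase wOut) ∧ l.Nodup := by
  rcases hP.trivial_or_exists with rfl | ⟨l, u, hl, rfl⟩
  · exfalso; apply ht; simp [topContacts_eq, inner]
  obtain ⟨hch, hhd, hadj, hV, hnd, -⟩ := (isMidWalk_cons_append_iff _ hl u).1 hP
  have hex : exV (wOut :: (l ++ [u])) = u := by simp [exV, finalDart_cons_append hl]
  have hin : inner (wOut :: (l ++ [u])) = l := inner_cons_append l u
  have hsplit : core H (wOut :: (l ++ [u])) ++ tl H (wOut :: (l ++ [u])) = l := by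
    rw [core, tl, hin]; exact List.rdropWhile_append_rtakeWhile
  have htl_top : ∀ t ∈ tl H (wOut :: (l ++ [u])), xi t ≠ -((H : ℤ) + 1) := by
    intro t htm
    have := List.mem_rtakeWhile_imp (p := notTop H) (l := inner (wOut :: (l ++ [u]))) (by rw [← tl]; exact htm)
    simpa [notTop] using this
  -- some vertex of `l` is on the top row, so `core ≠ []`
  have hcore : core H (wOut :: (l ++ [u])) ≠ [] := by
    intro h0
    have htl : tl H (wOut :: (l ++ [u])) = l := by simpa [h0] using hsplit
    apply ht
    rw [topContacts_eq, hin, List.countP_eq_zero]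
    intro t htm
    have := htl_top t (by rw [htl]; exact htm)
    push_cast
    simpa using this
  have hlast : (core H (wOut :: (l ++ [u]))).getLast? = some (topV H (wOut :: (l ++ [u]))) := by
    rw [topV, List.getLast?_eq_some_getLast hcore]; rfl
  have hv : (core H (wOut :: (l ++ [u]))).getLast hcore = topV H (wOut :: (l ++ [u])) := by
    rw [List.getLast?_eq_some_getLast hcore, Option.some_inj] at hlast; exact hlast
  have hvxi : xi (topV H (wOut :: (l ++ [u]))) = -((H : ℤ) + 1) := by
    have h1 := List.rdropWhile_last_not (p := notTop H) (l := inner (wOut :: (l ++ [u]))) (by rw [← core]; exact hcore)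
    rw [← hv]
    simpa [notTop, core] using h1
  have hxu : xi u = 0 := by
    have := hcls _ hc; rwa [finalDart_cons_append hl] at this
  -- the tail is not empty: the last inner vertex is adjacent to the bottom-line exit, the top contact is not
  have htl_ne : tl H (wOut :: (l ++ [u])) ≠ [] := by
    intro h0
    have hcl : core H (wOut :: (l ++ [u])) = l := by simpa [h0] using hsplit
    have hlv : l.getLast hl = topV H (wOut :: (l ++ [u])) := by
      rw [← hv]; congr 1; exact hcl.symm
    have hadj' := hadj
    rw [hlv] at hadj'
    have hH1 : (1 : ℤ) ≤ H := by exact_mod_cast hH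
    rcases xi_adj hadj' with h | h | h <;> rw [hxu, hvxi] at h <;> omega
  refine ⟨l, hl, by rw [hex], hin, hsplit, hcore, hlast, hvxi, htl_top, htl_ne, by rw [hex]; exact hxu, hch, hhd,
    by rw [hex]; exact hadj, hV, hnd⟩

/-- Heights and abscissae of the TAIL vertices: `1 ≤ −ξ ≤ H` and `|X − 3| < 3W`; and `a⁺` is in the core. [cite: Beaton2014RotatedHoneycomb, §4, proof of Proposition 11] -/
private theorem tail_bounds (hH : 1 ≤ H) (hcls : ∀ d, cls d → xi d.2 = 0) {P : List HV}
    (hP : IsMidWalk ((rotStripV (H + 1) Wd).erase wOut) P) (hc : cls (finalDart P)) (ht : topContacts (H + 1) P ≠ 0) :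
    (∀ x ∈ tl H P, 1 ≤ -xi x ∧ -xi x ≤ H ∧ |xX x - 3| < 3 * Wd ∧ x ≠ hvOrigin ∧ x ≠ wOut) ∧ hvOrigin ∈ core H P := by
  obtain ⟨l, hl, -, -, hsplit, hcore, -, -, htl_top, -, -, -, hhd, -, hV, hnd⟩ := anatomy hH hcls hP hc ht
  have hO_c : hvOrigin ∈ core H P := by
    cases hc' : core H P with
    | nil => exact absurd hc' hcore
    | cons a c' =>
      rw [← hsplit, hc', List.cons_append, List.head?_cons, Option.some_inj] at hhd
      rw [hhd]; exact List.mem_cons_self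
  refine ⟨fun x hx => ?_, hO_c⟩
  have hxO : x ≠ hvOrigin := by
    intro h; rw [← hsplit] at hnd; exact (List.disjoint_of_nodup_append hnd) hO_c (h ▸ hx)
  have h2 := hV x (hsplit ▸ List.mem_append_right _ hx)
  rw [mem_erase, mem_rotStripV_iff] at h2
  rcases h2.2 with h3 | h3 | ⟨h3, h4, h5⟩
  · exact absurd h3 h2.1
  · exact absurd h3 hxO
  · have h6 := htl_top x hx
    push_cast at h4
    exact ⟨h3, by omega, h5, hxO, h2.1⟩

/-- **Piece 1 is a top-class walk of `V₁` with the same contacts**, of length `|core|`.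
[cite: Beaton2014RotatedHoneycomb, §4, proof of Proposition 11 (the first piece is a `B`-walk of the same strip)] -/
private theorem piece₁_spec (hH : 1 ≤ H) (hcls : ∀ d, cls d → xi d.2 = 0) {P : List HV}
    (hP : IsMidWalk ((rotStripV (H + 1) Wd).erase wOut) P) (hc : cls (finalDart P)) (ht : topContacts (H + 1) P ≠ 0) :
    IsMidWalk ((rotStripV (H + 1) Wd).erase wOut) (piece₁ H P) ∧ IsRotTopDart (H + 1) (finalDart (piece₁ H P)) ∧
      mwLen (piece₁ H P) = (core H P).length ∧ topContacts (H + 1) (piece₁ H P) = topContacts (H + 1) P := by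
  obtain ⟨l, hl, -, hin, hsplit, hcore, hlast, hvxi, htl_top, -, -, hch, hhd, -, hV, hnd⟩ := anatomy hH hcls hP hc ht
  have hcl : (core H P).getLast hcore = topV H P := by
    rw [List.getLast?_eq_some_getLast hcore, Option.some_inj] at hlast; exact hlast
  -- `core` inherits chain / head / membership / nodup from `l = core ++ tl`
  have hchc : (core H P).IsChain hvGraph.Adj := by rw [← hsplit] at hch; exact (List.isChain_append.1 hch).1
  have hhdc : (core H P).head? = some hvOrigin := by
    rw [← hsplit, List.head?_append_of_ne_nil _ hcore] at hhd; exact hhd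
  have hVc : ∀ x ∈ core H P, x ∈ (rotStripV (H + 1) Wd).erase wOut :=
    fun x hx => hV x (hsplit ▸ List.mem_append_left _ hx)
  have hndc : (core H P).Nodup := by rw [← hsplit] at hnd; exact hnd.of_append_left
  have hup : hvGraph.Adj (topV H P) (xiDown (topV H P)) := adj_xiDown _
  have hxiup : xi (xiDown (topV H P)) = -((H : ℤ) + 1) - 1 := by rw [xi_xiDown, hvxi]
  have hH0 : (0 : ℤ) ≤ H := by positivity
  -- the up-neighbour is not the previous vertex (it is outside the domain, two rows up)
  have hprev : xiDown (topV H P) ≠ prevOf (core H P) := by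
    intro h
    have hmem : prevOf (core H P) ∈ wOut :: (core H P).dropLast := by
      rw [prevOf]; exact List.getLast_mem _
    rw [← h, List.mem_cons] at hmem
    rcases hmem with h1 | h1
    · have := congrArg xi h1; rw [hxiup, xi_wOut] at this; omega
    · have h2 := hVc _ (List.dropLast_subset _ h1)
      rw [mem_erase, mem_rotStripV_iff] at h2
      rcases h2.2 with h3 | h3 | ⟨-, h3, -⟩
      · exact h2.1 h3
      · have := congrArg xi h3; rw [hxiup, xi_hvOrigin] at this; omega
      · push_cast at h3; rw [hxiup] at h3; omega
  have hmw : IsMidWalk ((rotStripV (H + 1) Wd).erase wOut) (piece₁ H P) :=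
    (isMidWalk_cons_append_iff _ hcore _).2 ⟨hchc, hhdc, by rw [hcl]; exact hup, hVc, hndc, hprev⟩
  have hfd : finalDart (piece₁ H P) = (topV H P, xiDown (topV H P)) := by
    rw [piece₁, finalDart_cons_append hcore, hcl]
  refine ⟨hmw, ?_, ?_, ?_⟩
  · rw [hfd]; exact ⟨hvxi, hxiup⟩
  · rw [piece₁, mwLen_cons_append]
  · have h0 : (tl H P).countP (fun w => xi w = -((H + 1 : ℕ) : ℤ)) = 0 := by
      rw [List.countP_eq_zero]
      intro w hw
      have := htl_top w hw
      push_cast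
      simpa using this
    rw [topContacts_eq, topContacts_eq, piece₁, inner_cons_append, hin, ← hsplit, List.countP_append, h0, add_zero]

/-- **Piece 2 is a top-class walk of `D(H, 2W+1) ∖ {a⁻}` (at `y = 1`)**, of length `|tl| + 1`.
[cite: Beaton2014RotatedHoneycomb, §4, proof of Proposition 11 (the second piece, reversed, lives in the strip of height one less)] -/
private theorem piece₂_spec (hH : 1 ≤ H) (hcls : ∀ d, cls d → xi d.2 = 0) {P : List HV}
    (hP : IsMidWalk ((rotStripV (H + 1) Wd).erase wOut) P) (hc : cls (finalDart P)) (ht : topContacts (H + 1) P ≠ 0) :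
    IsMidWalk ((rotStripV H (2 * Wd + 1)).erase wOut) (piece₂ H P) ∧ IsRotTopDart H (finalDart (piece₂ H P)) ∧
      mwLen (piece₂ H P) = (tl H P).length + 1 := by
  obtain ⟨l, hl, -, -, hsplit, hcore, hlast, hvxi, htl_top, htl_ne, hxu, hch, -, hadj, hV, hnd⟩ := anatomy hH hcls hP hc ht
  obtain ⟨htail, -⟩ := tail_bounds hH hcls hP hc ht
  have hcl : (core H P).getLast hcore = topV H P := by
    rw [List.getLast?_eq_some_getLast hcore, Option.some_inj] at hlast; exact hlast
  have hσw : rebase (exV P) (exV P) = hvOrigin := rebase_self _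
  have hσxi : ∀ u, xi (rebase (exV P) u) = xi u := fun u => xi_rebase hxu u
  have hσadj : ∀ {a b : HV}, hvGraph.Adj a b → hvGraph.Adj (rebase (exV P) a) (rebase (exV P) b) :=
    fun h => (rebase (exV P)).map_rel_iff.2 h
  have hndt : (tl H P).Nodup := by rw [← hsplit] at hnd; exact hnd.of_append_right
  have hcht : (core H P ++ tl H P).IsChain hvGraph.Adj := by rw [hsplit]; exact hch
  -- the first and last tail vertices
  obtain ⟨t₁, t', htt⟩ : ∃ t₁ t', tl H P = t₁ :: t' := List.exists_cons_of_ne_nil htl_ne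
  have ht1mem : t₁ ∈ tl H P := by rw [htt]; exact List.mem_cons_self
  have hadj_vt : hvGraph.Adj (topV H P) t₁ :=
    (List.isChain_append.1 hcht).2.2 _ (by rw [hlast]; exact Option.mem_some_iff.mpr rfl) _ (by rw [htt]; rfl)
  have hadj_tw : hvGraph.Adj ((tl H P).getLast htl_ne) (exV P) := by
    have : l.getLast hl = (tl H P).getLast htl_ne := by simp only [← hsplit, List.getLast_append_of_ne_nil _ htl_ne]
    rw [← this]; exact hadj
  have ht1_xi : xi t₁ = -(H : ℤ) := by
    obtain ⟨h1, h2, -⟩ := htail t₁ ht1mem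
    rcases xi_adj hadj_vt with h | h | h <;> rw [hvxi] at h <;> omega
  -- abscissa of the exit vertex
  have hwX : |xX (exV P) - 3| ≤ 3 * Wd + 1 := by
    obtain ⟨-, -, h3, -⟩ := htail _ (List.getLast_mem htl_ne)
    have h4 := abs_xX_sub_le_of_adj hadj_tw
    have := abs_sub_le (xX (exV P)) (xX ((tl H P).getLast htl_ne)) 3
    linarith
  -- the inner list of piece 2
  set m : List HV := (exV P :: (tl H P).reverse).map (rebase (exV P)) with hmdef
  have hm_eq : m = hvOrigin :: ((tl H P).reverse.map (rebase (exV P))) := by rw [hmdef, List.map_cons, hσw]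
  have hm_ne : m ≠ [] := by rw [hm_eq]; exact List.cons_ne_nil _ _
  have hm_head : m.head? = some hvOrigin := by rw [hm_eq]; rfl
  have hrev_ne : (tl H P).reverse ≠ [] := by simpa using htl_ne
  have hm_last : m.getLast hm_ne = rebase (exV P) t₁ := by
    rw [List.getLast_eq_iff_getLast?_eq_some] -- m.getLast? = some _
    rw [hm_eq, List.getLast?_cons_of_ne_nil (by simpa using htl_ne)]  -- name guess; fixed below if needed
    rw [List.map_reverse, List.getLast?_reverse, List.head?_map, htt]
    rfl
  have hm_chain : m.IsChain hvGraph.Adj := by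
    rw [hmdef]
    refine (List.isChain_map _).2 ?_
    have hc2 : (exV P :: (tl H P).reverse).IsChain hvGraph.Adj := by
      refine List.IsChain.cons_of_ne_nil hrev_ne ?_ ?_  -- name guess
      · exact List.isChain_reverse.2 ((List.isChain_append.1 hcht).2.1.imp fun _ _ h => h.symm)
      · rw [List.head_reverse]; exact hadj_tw.symm
    exact hc2.imp fun _ _ h => hσadj h
  -- membership of the inner vertices of piece 2 in `D(H, 2W+1) ∖ {a⁻}`
  have hWd : (0 : ℤ) ≤ Wd := by positivity
  have hm_mem : ∀ x ∈ m, x ∈ (rotStripV H (2 * Wd + 1)).erase wOut := by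
    intro x hx
    rw [hm_eq, List.mem_cons] at hx
    rcases hx with rfl | hx
    · exact mem_erase.2 ⟨by decide, hvOrigin_mem_rotStripV _ _⟩
    · rw [List.mem_map] at hx
      obtain ⟨t, htm, rfl⟩ := hx
      rw [List.mem_reverse] at htm
      obtain ⟨h1, h2, h3, -, -⟩ := htail t htm
      have hxt : xi (rebase (exV P) t) = xi t := hσxi t
      refine mem_erase.2 ⟨fun h => ?_, mem_rotStripV_iff.2 (Or.inr (Or.inr ⟨by rw [hxt]; exact h1, by rw [hxt]; exact h2, ?_⟩))⟩
      · have := congrArg xi h; rw [hxt, xi_wOut] at this; omega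
      · have h5 := abs_xX_rebase (exV P) t
        have h6 := abs_sub_le (xX t) 3 (xX (exV P))
        rw [abs_sub_comm 3 (xX (exV P))] at h6
        push_cast
        linarith
  have hm_nodup : m.Nodup := by
    rw [hm_eq, List.nodup_cons]
    refine ⟨fun hx => ?_, (List.nodup_reverse.2 hndt).map (rebase (exV P)).injective⟩
    rw [List.mem_map] at hx
    obtain ⟨t, htm, hte⟩ := hx
    rw [List.mem_reverse] at htm
    have h1 := (htail t htm).1
    have := congrArg xi hte; rw [hσxi, xi_hvOrigin] at this; omega
  have hvxi' : xi (rebase (exV P) (topV H P)) = -((H : ℤ) + 1) := by rw [hσxi, hvxi]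
  have hprev : rebase (exV P) (topV H P) ≠ prevOf m := by
    intro h
    have hmem : prevOf m ∈ wOut :: m.dropLast := by rw [prevOf]; exact List.getLast_mem _
    rw [← h, List.mem_cons] at hmem
    have hH0 : (0 : ℤ) ≤ H := by positivity
    rcases hmem with h1 | h1
    · have := congrArg xi h1; rw [hvxi', xi_wOut] at this; omega
    · have h2 := hm_mem _ (List.dropLast_subset _ h1)
      rw [mem_erase, mem_rotStripV_iff] at h2
      rcases h2.2 with h3 | h3 | ⟨-, h3, -⟩
      · exact h2.1 h3
      · have := congrArg xi h3; rw [hvxi', xi_hvOrigin] at this; omega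
      · rw [hvxi'] at h3; omega
  have hmw : IsMidWalk ((rotStripV H (2 * Wd + 1)).erase wOut) (piece₂ H P) := by
    rw [piece₂, ← hmdef]
    exact (isMidWalk_cons_append_iff _ hm_ne _).2
      ⟨hm_chain, hm_head, by rw [hm_last]; exact hσadj hadj_vt.symm, hm_mem, hm_nodup, hprev⟩
  have hfd : finalDart (piece₂ H P) = (rebase (exV P) t₁, rebase (exV P) (topV H P)) := by
    rw [piece₂, ← hmdef, finalDart_cons_append hm_ne, hm_last]
  refine ⟨hmw, ?_, ?_⟩
  · rw [hfd]; exact ⟨by rw [hσxi, ht1_xi], by rw [hvxi']; ring⟩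
  · rw [piece₂, ← hmdef, mwLen_cons_append, hmdef, List.length_map, List.length_cons, List.length_reverse]

/-- **Length and contact bookkeeping of the cut**: `ℓ(γ) + 1 = ℓ(piece₁) + ℓ(piece₂)` and `c(γ) = c(piece₁)`.
[cite: Beaton2014RotatedHoneycomb, §4, proof of Proposition 11] -/
private theorem cut_len (hH : 1 ≤ H) (hcls : ∀ d, cls d → xi d.2 = 0) {P : List HV}
    (hP : IsMidWalk ((rotStripV (H + 1) Wd).erase wOut) P) (hc : cls (finalDart P)) (ht : topContacts (H + 1) P ≠ 0) :
    mwLen P + 1 = mwLen (piece₁ H P) + mwLen (piece₂ H P) ∧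
      topContacts (H + 1) P = topContacts (H + 1) (piece₁ H P) := by
  obtain ⟨l, hl, hPeq, -, hsplit, -⟩ := anatomy hH hcls hP hc ht
  obtain ⟨-, -, h1, h1'⟩ := piece₁_spec hH hcls hP hc ht
  obtain ⟨-, -, h2⟩ := piece₂_spec hH hcls hP hc ht
  refine ⟨?_, h1'.symm⟩
  have : mwLen P = l.length := by rw [hPeq, mwLen_cons_append]
  rw [this, h1, h2, ← hsplit, List.length_append]; ring

/-- **The cut is injective** on the class walks with a top contact (the frame of piece 2 is recovered from the last top contact,
the type of the re-based top vertex telling a translation from a glide). [cite: Beaton2014RotatedHoneycomb, §4, proof of Proposition 11] -/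
private theorem cut_inj (hH : 1 ≤ H) (hcls : ∀ d, cls d → xi d.2 = 0) {P P' : List HV}
    (hP : IsMidWalk ((rotStripV (H + 1) Wd).erase wOut) P) (hc : cls (finalDart P)) (ht : topContacts (H + 1) P ≠ 0)
    (hP' : IsMidWalk ((rotStripV (H + 1) Wd).erase wOut) P') (hc' : cls (finalDart P')) (ht' : topContacts (H + 1) P' ≠ 0)
    (h : cut H P = cut H P') : P = P' := by
  obtain ⟨l, hl, hPeq, -, hsplit, hcore, hlast, -⟩ := anatomy hH hcls hP hc ht
  obtain ⟨l', hl', hPeq', -, hsplit', hcore', hlast', -⟩ := anatomy hH hcls hP' hc' ht'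
  simp only [cut, Prod.mk.injEq, piece₁, piece₂, List.cons.injEq, true_and] at h
  obtain ⟨h1, h2⟩ := h
  -- piece 1: the cores agree, hence the top vertices
  have hc1 : core H P = core H P' := by simpa using congrArg List.dropLast h1
  have hv : topV H P = topV H P' := by
    rw [hc1] at hlast; rw [hlast] at hlast'; exact Option.some_inj.1 hlast'.symm |>.symm
  -- piece 2: the frames agree (same value at the top vertex), hence the tails and the exit vertices
  have hlast2 := congrArg List.getLast? h2
  simp only [List.getLast?_concat] at hlast2
  rw [hv] at hlast2
  have hw : exV P = exV P' := rebase_inj_param (Option.some_inj.1 hlast2)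
  have hm := congrArg List.dropLast h2
  simp only [List.dropLast_concat] at hm
  rw [hw] at hm
  have hm' := (List.map_injective_iff.2 (rebase (exV P')).injective) hm
  simp only [List.cons.injEq, true_and, List.reverse_inj] at hm'
  rw [hPeq, hPeq', ← hsplit, ← hsplit', hc1, hm', hw]

/-! ### The sums -/

/-- The class-`cls` walks of `V₁ = D(H+1, W) ∖ {a⁻}` WITHOUT top contact are exactly the class-`cls` walks of `V₀ = D(H, W) ∖ {a⁻}`.
[cite: Beaton2014RotatedHoneycomb, §4, proof of Proposition 11 (walks of the taller strip not touching its top row)] -/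
theorem filter_noContact_eq (H Wd : ℕ) (cls : HV × HV → Prop) [DecidablePred cls] :
    (midWalks ((rotStripV (H + 1) Wd).erase wOut)).filter (fun P => cls (finalDart P) ∧ topContacts (H + 1) P = 0) =
      (midWalks ((rotStripV H Wd).erase wOut)).filter (fun P => cls (finalDart P)) := by
  ext P
  simp only [mem_filter, mem_midWalks_iff, topContacts_eq, List.countP_eq_zero, decide_eq_true_eq]
  constructor
  · rintro ⟨hP, hc, h0⟩
    refine ⟨⟨hP.1, hP.2.1, hP.2.2.1, fun x hx => ?_, hP.2.2.2.2.1, hP.2.2.2.2.2⟩, hc⟩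
    have h1 := hP.2.2.2.1 x hx
    rw [mem_erase, mem_rotStripV_iff] at h1 ⊢
    refine ⟨h1.1, ?_⟩
    rcases h1.2 with h2 | h2 | ⟨h2, h3, h4⟩
    · exact Or.inl h2
    · exact Or.inr (Or.inl h2)
    · have h5 := h0 x hx
      push_cast at h3 h5
      exact Or.inr (Or.inr ⟨h2, by omega, h4⟩)
  · rintro ⟨hP, hc⟩
    refine ⟨hP.mono (erase_subset_erase _ (rotStripV_mono_height' (Nat.le_succ H))), hc, fun x hx => ?_⟩
    have h1 := hP.2.2.2.1 x hx
    rw [mem_erase, mem_rotStripV_iff] at h1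
    rcases h1.2 with h2 | h2 | ⟨-, h3, -⟩
    · exact absurd h2 h1.1
    · rw [h2, xi_hvOrigin]; push_cast; omega
    · push_cast; omega

/-- `X_{H+1,W}(y) = X_{H,W}(1) + Σ_{class walks of D(H+1,W) with a top contact} x_c^ℓ y^c`.
[cite: Beaton2014RotatedHoneycomb, §4, proof of Proposition 11] -/
theorem rotGFy_eq_rotGF_add (H Wd : ℕ) (cls : HV × HV → Prop) [DecidablePred cls] (y : ℝ) :
    rotGFy ((rotStripV (H + 1) Wd).erase wOut) (H + 1) cls y = rotGF ((rotStripV H Wd).erase wOut) cls +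
      ∑ P ∈ (midWalks ((rotStripV (H + 1) Wd).erase wOut)).filter
          (fun P => cls (finalDart P) ∧ topContacts (H + 1) P ≠ 0),
        hexCriticalFugacity ^ mwLen P * y ^ topContacts (H + 1) P := by
  rw [rotGFy, ← sum_filter_add_sum_filter_not _ (fun P => topContacts (H + 1) P = 0), filter_filter, filter_filter]
  congr 1
  rw [filter_noContact_eq, rotGF]
  refine sum_congr rfl fun P hP => ?_
  -- no contact in `D(H, W)`: the `y`-weight is `1`
  have h0 : topContacts (H + 1) P = 0 := by
    have := (mem_filter.1 (filter_noContact_eq H Wd cls ▸ hP : P ∈ (midWalks ((rotStripV (H + 1) Wd).erase wOut)).filter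
      (fun P => cls (finalDart P) ∧ topContacts (H + 1) P = 0))).2.2
    exact this
  rw [h0, pow_zero, mul_one]

/-- **The last-contact cut (face Y2, constant `x_c⁻¹`)**: for a class `cls` of walks leaving through the bottom line (`ξ = 0` at the
exit vertex: `A^O`, `A^I`, `P`), `H ≥ 1`, `y ≥ 0`,
`X_{H+1,W}(y) − X_{H,W}(1) ≤ x_c⁻¹ · B^{⊥,→}_{H+1,W}(y) · B^{⊥,→}_{H,2W+1}(1)`.
[cite: Beaton2014RotatedHoneycomb, §4, proof of Proposition 11 (arXiv v3 p. 18, Fig. 7); printed constant (1+x_c)/2, here x_c⁻¹ (right-started normalisation)] -/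
theorem rot_arch_cut {H : ℕ} (hH : 1 ≤ H) (Wd : ℕ) (cls : HV × HV → Prop) [DecidablePred cls]
    (hcls : ∀ d, cls d → xi d.2 = 0) {y : ℝ} (hy : 0 ≤ y) :
    rotGFy ((rotStripV (H + 1) Wd).erase wOut) (H + 1) cls y - rotGF ((rotStripV H Wd).erase wOut) cls ≤
      hexCriticalFugacity⁻¹ * rotGFy ((rotStripV (H + 1) Wd).erase wOut) (H + 1) (IsRotTopDart (H + 1)) y *
        rotStripBR H (2 * Wd + 1) := by
  have hx := hexCriticalFugacity_pos_lt_one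
  set V₁ := (rotStripV (H + 1) Wd).erase wOut with hV₁
  set V₀' := (rotStripV H (2 * Wd + 1)).erase wOut with hV₀'
  set S := (midWalks V₁).filter (fun P => cls (finalDart P) ∧ topContacts (H + 1) P ≠ 0) with hS
  set T₁ := (midWalks V₁).filter (fun P => IsRotTopDart (H + 1) (finalDart P)) with hT₁
  set T₀ := (midWalks V₀').filter (fun P => IsRotTopDart H (finalDart P)) with hT₀
  set g : List HV × List HV → ℝ := fun q =>
    hexCriticalFugacity ^ mwLen q.1 * y ^ topContacts (H + 1) q.1 * hexCriticalFugacity ^ mwLen q.2 with hg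
  rw [rotGFy_eq_rotGF_add, add_sub_cancel_left]
  have hmem : ∀ P ∈ S, IsMidWalk V₁ P ∧ cls (finalDart P) ∧ topContacts (H + 1) P ≠ 0 := fun P hP => by
    have h := mem_filter.1 hP; exact ⟨mem_midWalks_iff.1 h.1, h.2.1, h.2.2⟩
  -- termwise: the weight of `P` is `x⁻¹ · g (cut P)`
  have hterm : ∀ P ∈ S, hexCriticalFugacity ^ mwLen P * y ^ topContacts (H + 1) P =
      hexCriticalFugacity⁻¹ * g (cut H P) := by
    intro P hP
    obtain ⟨h1, h2, h3⟩ := hmem P hP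
    obtain ⟨hlen, htc⟩ := cut_len hH hcls h1 h2 h3
    simp only [hg, cut]
    rw [← htc]
    have e : hexCriticalFugacity ^ mwLen P = hexCriticalFugacity⁻¹ *
        (hexCriticalFugacity ^ mwLen (piece₁ H P) * hexCriticalFugacity ^ mwLen (piece₂ H P)) := by
      rw [← pow_add, ← hlen, pow_succ, mul_comm (hexCriticalFugacity ^ mwLen P), ← mul_assoc,
        inv_mul_cancel₀ hx.1.ne', one_mul]
    rw [e]; ring
  rw [sum_congr rfl hterm, ← mul_sum]
  -- the cut is injective on `S` and lands in `T₁ × T₀`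
  have hinj : Set.InjOn (cut H) ↑S := by
    intro P hP P' hP' h
    obtain ⟨h1, h2, h3⟩ := hmem P (Finset.mem_coe.1 hP)
    obtain ⟨h1', h2', h3'⟩ := hmem P' (Finset.mem_coe.1 hP')
    exact cut_inj hH hcls h1 h2 h3 h1' h2' h3' h
  have himg : S.image (cut H) ⊆ T₁ ×ˢ T₀ := by
    intro q hq
    obtain ⟨P, hP, rfl⟩ := mem_image.1 hq
    obtain ⟨h1, h2, h3⟩ := hmem P hP
    obtain ⟨a1, a2, -⟩ := piece₁_spec hH hcls h1 h2 h3
    obtain ⟨b1, b2, -⟩ := piece₂_spec hH hcls h1 h2 h3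
    exact mem_product.2 ⟨mem_filter.2 ⟨mem_midWalks_iff.2 a1, a2⟩, mem_filter.2 ⟨mem_midWalks_iff.2 b1, b2⟩⟩
  have hg0 : ∀ q ∈ T₁ ×ˢ T₀, 0 ≤ g q := fun q _ => by
    simp only [hg]
    exact mul_nonneg (mul_nonneg (pow_nonneg hx.1.le _) (pow_nonneg hy _)) (pow_nonneg hx.1.le _)
  have hsum : ∑ P ∈ S, g (cut H P) ≤ ∑ q ∈ T₁ ×ˢ T₀, g q := by
    rw [← sum_image hinj]
    exact sum_le_sum_of_subset_of_nonneg himg fun q hq _ => hg0 q hq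
  have hprod : ∑ q ∈ T₁ ×ˢ T₀, g q =
      rotGFy V₁ (H + 1) (IsRotTopDart (H + 1)) y * rotStripBR H (2 * Wd + 1) := by
    rw [sum_product, rotGFy, rotStripBR_eq_rotGF, rotGF, ← hT₁, ← hV₀', ← hT₀, sum_mul]
    refine sum_congr rfl fun a _ => ?_
    rw [mul_sum]
  calc hexCriticalFugacity⁻¹ * ∑ P ∈ S, g (cut H P)
      ≤ hexCriticalFugacity⁻¹ * ∑ q ∈ T₁ ×ˢ T₀, g q := mul_le_mul_of_nonneg_left hsum (inv_nonneg.2 hx.1.le)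
    _ = _ := by rw [hprod, mul_assoc]

/-- **Face Y2 of the lane's door R96 with the constant `x_c⁻¹`**: `X_{H+1,W}(y) − X_{H,W}(1) ≤ x_c⁻¹ · B^{⊥,→}_{H+1,W}(y) ·
⨆_{W'} B^{⊥,→}_{H,W'}(1)` for `X ∈ {A^O, A^I, P}` (`IsRotBotOut`, `IsRotBotIn`, `IsRotCloseDart`), `H, W ≥ 1`, `y ≥ 0`.
[cite: Beaton2014RotatedHoneycomb, §4, proof of Proposition 11 (arXiv v3 p. 18, Fig. 7)] -/
theorem rot_arch_cut_iSup {H : ℕ} (hH : 1 ≤ H) (Wd : ℕ) {y : ℝ} (hy : 0 ≤ y) :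
    let V₁ := (rotStripV (H + 1) Wd).erase wOut
    let V₀ := (rotStripV H Wd).erase wOut
    (rotGFy V₁ (H + 1) IsRotBotOut y - rotGF V₀ IsRotBotOut ≤
        hexCriticalFugacity⁻¹ * rotGFy V₁ (H + 1) (IsRotTopDart (H + 1)) y * (⨆ W : ℕ, rotStripBR H W)) ∧
    (rotGFy V₁ (H + 1) IsRotBotIn y - rotGF V₀ IsRotBotIn ≤
        hexCriticalFugacity⁻¹ * rotGFy V₁ (H + 1) (IsRotTopDart (H + 1)) y * (⨆ W : ℕ, rotStripBR H W)) ∧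
    (rotGFy V₁ (H + 1) IsRotCloseDart y - rotGF V₀ IsRotCloseDart ≤
        hexCriticalFugacity⁻¹ * rotGFy V₁ (H + 1) (IsRotTopDart (H + 1)) y * (⨆ W : ℕ, rotStripBR H W)) := by
  have hx := hexCriticalFugacity_pos_lt_one
  have hsup : rotStripBR H (2 * Wd + 1) ≤ ⨆ W : ℕ, rotStripBR H W := le_ciSup (rotStripBR_bddAbove hH) _
  have hB0 : 0 ≤ hexCriticalFugacity⁻¹ * rotGFy ((rotStripV (H + 1) Wd).erase wOut) (H + 1) (IsRotTopDart (H + 1)) y := by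
    exact mul_nonneg (inv_nonneg.2 hx.1.le) (sum_nonneg fun P _ => mul_nonneg (pow_nonneg hx.1.le _) (pow_nonneg hy _))
  have key := fun (cls : HV × HV → Prop) [DecidablePred cls] (hcls : ∀ d, cls d → xi d.2 = 0) =>
    (rot_arch_cut hH Wd cls hcls hy).trans (mul_le_mul_of_nonneg_left hsup hB0)
  refine ⟨key IsRotBotOut fun d hd => hd.1.2.1, key IsRotBotIn fun d hd => hd.1.2.1, key IsRotCloseDart fun d hd => ?_⟩
  rw [IsRotCloseDart] at hd; rw [hd, xi_wOut]

end Cut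

end Literature.Probability.RandomPlanarGeometry.SAW.HV
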